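import Summits.HodgeConjecture.HodgeConjecture.Theorems.F0P3cStCharTSTorusDefs      -- ★ p849564 (LH6-p01 (g2)): `vanDijkWeight`, `torusChart`, `torusTransform`, `torusChartEntries_reflect` (brings ★ (4.9.4) `CMPrincipalSeriesTraceOrbitalForm`)
import Summits.HodgeConjecture.HodgeConjecture.Theorems.F0P2oBorelTorusModulus       -- ★ `rootDeltaChar_cmBorel_torus` (`δ_B^{1∕2}(t) = ‖t₀₀‖`)
import Literature.NumberTheory.Automorphic.CMBorelWeylTorusConjugate                 -- ★ `weylConj_mem_cmTorus`, `glDiagonal_rev_eq_weylConj` (`ʷ(diag d) = diag (d ∘ rev)`)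
import Summits.HodgeConjecture.HodgeConjecture.Theorems.F0P3cStCharTSReflScalars      -- ★ part 1∕2 (this seat): the reflected regular scalars and their modules (brings ★ `twistModule_cmLocal_eq`)
import HarnessLib

/-!
# F0 · P3c · line LH6 «StCharTS» — brick «VDW-SYMM★» (P4 + P2 of `CENSUS-PSM`): THE WEYL SYMMETRY OF VAN DIJK'S WEIGHT `Δ(ʷt) = Δ(t)`
# and of the torus transform `F_φ(ω m) = F_φ(m)`  [Rogawski1990, §12.7 L. 12.7.2 (proof) p. 193; §4.9 (4.9.4) p. 56; §12.2 p. 173]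

Cell `pub/hodgecm-mathlib`, crux H413 = `stmt-HodgeConjecture-24833` (lane `--supports … --as helper`), route HCCMUnconditional; seat LH6-p02 (g2),
DEAL «VDW-SYMM★» of the LH6 desk F0P3b-plan (g23) 2026-09-02T05:36:54Z (= lemma P4 + the P2 one-liner of LH6-p01 (g2)'s census
`F0/P3b/LH6-p01/g2/CENSUS-PSM.v1.md` 15be680377210942 ∕ TERMS `CENSUS-PSM.v2-TERMS.md` 1eb74f73e3a41ae8 §0, consumer «PSM★» = the (PSM) clause of the
(TOR) conjunct of the (S-𝔇) package `stub_EllipticPackage` of `Cruxes/H413/Lines/F0_P3c_StCharTSPaydown.lean` ED. 5).  THEOREMS ONLY (no definition, no instance,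
no notation, no named fact, no `sorry`); ★-only imports.  HONEST LABEL: HC_CM is proved only modulo the 7 printed citations (2 remaining: hLiu418 =
stmt-HodgeConjecture-24832, h413 = stmt-HodgeConjecture-24833) until rung 0 closes; (TOR)-road plumbing, count-neutral, closes nothing by itself.

THE MATHEMATICS.  `G = U(Φ₃)(L⁺_v)` (matrix carrier `↥(unitaryGroupOfForm (c̄ ⊗ 1) Φ₃)` over `R = ∏_{w∣v} L_w`), `T` its diagonal torus, `t = d(d₀, d₁, d₂) ∈ T`
(so `σ(d₂)d₀ = σ(d₁)d₁ = σ(d₀)d₂ = 1`, ★ `HeisRing.torus_relations`), `w₀ ∈ G` any element whose matrix is `Φ₃` (★ `CMBorelWeylTorusConjugate`; one exists,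
`exists_weylElt`), `ʷt := w₀ t w₀⁻¹ = d(d₂, d₁, d₀)` (★ `glDiagonal_rev_eq_weylConj`).  Van Dijk's weight of ★ (4.9.4)
`smoothTrace_cmPrincipalSeries_map_symm_eq_inv_mul_integral` (= LH6-p01's ★ `vanDijkWeight`, print's `Δ(m)` p. 193) is
  `Δ(t) = δ_B^{1∕2}(t) · (‖a − 1‖⁻¹ · χ⁻(b − 1)⁻¹)⁻¹`,  `a = d₀⁻¹d₁`, `b = d₀⁻¹d₂`,
with `δ_B^{1∕2}(t) = ‖d₀‖` (★ `rootDeltaChar_cmBorel_torus`) and `(‖a − 1‖⁻¹ · χ⁻(b − 1)⁻¹) = (‖a − 1‖ · √‖b − 1‖)⁻¹` (★ `twistModule_cmLocal_eq`), i.e.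
`Δ(t) = ‖d₀‖ · ‖a − 1‖ · √‖b − 1‖`.  For the reflected diagonal `d' = (d₂, d₁, d₀)`:
* part 1 (★ `Theorems/F0P3cStCharTSReflScalars`, ring-generic): `a' − 1 = −(d₂⁻¹d₁)·σ(a − 1)`, `b' − 1 = −(d₂⁻¹d₀)·(b − 1)`; hence the regular scalars of `ʷt`
  are units iff those of `t` are, and **`‖a' − 1‖ = ‖a − 1‖ · ‖d₀‖`**, **`‖b' − 1‖ = ‖b − 1‖ · ‖d₀‖²`** (so `√‖b' − 1‖ = √‖b − 1‖ · ‖d₀‖`);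
* §2 (CM dress): `δ_B^{1∕2}(ʷt) = ‖d₂‖ = ‖d₀‖⁻¹`, so `Δ(ʷt) = ‖d₀‖⁻¹ · ‖a − 1‖‖d₀‖ · √‖b − 1‖‖d₀‖ = Δ(t)` — **`vanDijkWeight_weylConj_tokens`** (both sides the
  ★ (4.9.4) weight VERBATIM, for ANY diagonal writings `d` of `t` and `d'` of `ʷt`) and **`vanDijkWeight_weylConj`** (LH6-p01's `dite`, regular or not);
* §3 (P2): `ʷt` and `t` are conjugate, so every class function agrees on them — `classOrbitalIntegral m f ⟦e ʷt⟧ = classOrbitalIntegral m f ⟦e t⟧` for any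
  hom `e` (the frame of ★ (4.9.4), or the identity on `Gqs L v`); with LH6-p01's ★ `torusChartEntries_reflect` (`ι(ω m)` has the reversed entries of `ι m`):
  `ι(ω m) = ʷ(ι m)` and **`torusTransform_reflect`: `F_φ(ω m) = F_φ(m)`** for the torus transform of the TERMS leaf, `ω(α, z) = (σ(α)⁻¹, z)` — the
  W-invariance of print's `F_f` [p. 193 «`F_f` is invariant under the Weyl group»], with NO Weyl-element binder (one is produced inside the proof).
This is the «`Tr i_G(wχ) = Tr i_G(χ)`» half of (PSM) [§12.2 p. 173: `i_G(χ)` and `i_G(wχ)` have the same character] in the form «PSM★» consumes it: van Dijk's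
formula ★ (4.9.4) at `χ` and at `wχ` differ exactly by the substitution `t ↦ ʷt` in the weight × orbital-integral factor, which this file shows is invariant.

## References
* [Rogawski1990] J. D. Rogawski, *Automorphic Representations of Unitary Groups in Three Variables*, Ann. of Math. Stud. 123 (1990): §1.10 p. 9 (`Φ₃` normalises
  `T`); §4.9 Lemma 4.9.2, (4.9.4) p. 56; §12.2 p. 173 (`w(χ₁, χ₂) = (χ̄₁⁻¹, χ₂)`, `i_G(χ)` vs `i_G(wχ)`); §12.5 p. 182–183; §12.7 Lemma 12.7.2 (proof) p. 193 (`F_f(m) =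
  Δ(m)Φ(m, f)`, Weyl-invariant).
* [vanDijk1972] G. van Dijk, *Computation of certain induced characters of 𝔭-adic groups*, Math. Ann. 199 (1972), Thm. p. 237.
* [GetzHahn2024] J. R. Getz, H. Hahn, *An Introduction to Automorphic Representations*, GTM 300 (2024), §3.5 (3.10) (modules of automorphisms).
-/

set_option autoImplicit false
-- the mandated namespace has the single-problem summit's repeated segment (`HodgeConjecture.HodgeConjecture`)
set_option linter.dupNamespace false

noncomputable section

open NumberField IsDedekindDomain MeasureTheory Topology
open scoped Matrix MatrixGroups NNReal
open Literature.NumberTheory.Rogawski1990 Literature.NumberTheory.Automorphic Literature.NumberTheory.Automorphic.UnitaryGroup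
open Literature.NumberTheory.Automorphic.UnitaryGroup.HeisRing

namespace Summit.HodgeConjecture.HodgeConjecture.Cruxes.H413.F0P3cStCharTSVanDijkWeylSymm

open F0P3cStCharTSReflScalars

/-! ## §2 (part 2) The CM local ring `R = ∏_{w∣v} L_w`, `σ = c̄ ⊗ 1`: `Δ(ʷt) = Δ(t)` in the tokens of ★ (4.9.4) -/

section CM

variable (L : Type) [Field L] [NumberField L] [IsCMField L] (v : HeightOneSpectrum (𝓞 ↥(maximalRealSubfield L)))

/-- **A WEYL ELEMENT EXISTS**: some `w₀ ∈ U(Φ₃)(L⁺_v)` has matrix `Φ₃ = cmLocalForm L 3 v` (the unit underlying the form matrix itself: `(σΦ₃)ᵀΦ₃Φ₃ = Φ₃³ = Φ₃`,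
★ `StdForm.isUnit_over`∕`over_map`∕`transpose_over`∕`over_mul_over`). [cite: Rogawski1990, §1.10 p. 9] -/
theorem exists_weylElt :
    ∃ w₀ : ↥(unitaryGroupOfForm (conjLocal L (IsCMField.complexConj L) v) (cmLocalForm L 3 v)),
      Units.val (w₀ : GL (Fin 3) (LocalRing L v)) = cmLocalForm L 3 v := by
  have hJ := cmLocalForm_eq_over L 3 v
  refine ⟨⟨((StdForm.antidiagonal 3).isUnit_over (LocalRing L v)).unit, ?_⟩, ?_⟩
  · rw [mem_unitaryGroupOfForm_iff, IsUnit.unit_spec, hJ, StdForm.over_map, StdForm.transpose_over, StdForm.over_mul_over, Matrix.one_mul]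
  · exact (((StdForm.antidiagonal 3).isUnit_over (LocalRing L v)).unit_spec).trans hJ.symm

variable (w₀ : ↥(unitaryGroupOfForm (conjLocal L (IsCMField.complexConj L) v) (cmLocalForm L 3 v)))
  (hw₀ : Units.val (w₀ : GL (Fin 3) (LocalRing L v)) = cmLocalForm L 3 v)

include hw₀ in
/-- The diagonal writings of `t` and of `ʷt` are reverse to each other: `d'ᵢ = d_{2−i}`. [cite: Rogawski1990, §1.10 p. 9] -/
theorem reflDiag_apply (t t' : ↥(cmBorelTriple L 3 v).M)
    (ht' : (t' : ↥(unitaryGroupOfForm (conjLocal L (IsCMField.complexConj L) v) (cmLocalForm L 3 v))) =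
      w₀ * (t : ↥(unitaryGroupOfForm (conjLocal L (IsCMField.complexConj L) v) (cmLocalForm L 3 v))) * w₀⁻¹)
    {d : Fin 3 → (LocalRing L v)ˣ}
    (hd : glDiagonal 3 (LocalRing L v) d = ((t : ↥(unitaryGroupOfForm (conjLocal L (IsCMField.complexConj L) v) (cmLocalForm L 3 v))) : GL (Fin 3) (LocalRing L v)))
    {d' : Fin 3 → (LocalRing L v)ˣ}
    (hd' : glDiagonal 3 (LocalRing L v) d' = ((t' : ↥(unitaryGroupOfForm (conjLocal L (IsCMField.complexConj L) v) (cmLocalForm L 3 v))) : GL (Fin 3) (LocalRing L v)))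
    (i : Fin 3) : d' i = d i.rev := by
  have hd'' : glDiagonal 3 (LocalRing L v) (fun i => d i.rev) =
      ((t' : ↥(unitaryGroupOfForm (conjLocal L (IsCMField.complexConj L) v) (cmLocalForm L 3 v))) : GL (Fin 3) (LocalRing L v)) := by
    rw [ht']
    exact glDiagonal_rev_eq_weylConj (conjLocal L (IsCMField.complexConj L) v) (cmLocalForm_eq_over L 3 v) w₀ hw₀ t hd
  rw [← torusEntry_eq_of_glDiagonal_eq (conjLocal L (IsCMField.complexConj L) v) (cmLocalForm L 3 v) i t' d' hd',
    torusEntry_eq_of_glDiagonal_eq (conjLocal L (IsCMField.complexConj L) v) (cmLocalForm L 3 v) i t' (fun i => d i.rev) hd'']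

/-- Scalar bookkeeping in `ℂ`: `x⁻¹ · ((A x)(S x))⁻¹⁻¹ = x · ((A S)⁻¹)⁻¹` for `x ≠ 0` (casts `ℝ≥0 → ℝ → ℂ`). [folklore] -/
theorem weight_scalar_aux (x A S : ℝ≥0) (hx : x ≠ 0) :
    (((x⁻¹ : ℝ≥0) : ℝ) : ℂ) * ((((A * x * (S * x))⁻¹ : ℝ≥0) : ℝ) : ℂ)⁻¹ = ((x : ℝ) : ℂ) * ((((A * S)⁻¹ : ℝ≥0) : ℝ) : ℂ)⁻¹ := by
  have hx' : ((x : ℝ) : ℂ) ≠ 0 := by exact_mod_cast hx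
  push_cast
  rw [inv_inv, inv_inv]
  field_simp

set_option maxHeartbeats 400000 in
include hw₀ in
/-- **VAN DIJK'S WEIGHT IS WEYL-INVARIANT, in the tokens of ★ (4.9.4)** `smoothTrace_cmPrincipalSeries_map_symm_eq_inv_mul_integral`: for `t ∈ T`, `ʷt = w₀ t w₀⁻¹`
(`t'` with `ht'`), ANY diagonal writings `d` of `t` and `d'` of `ʷt` with the regular scalars units,
`δ_B^{1∕2}(ʷt)·(‖a'−1‖⁻¹·χ⁻(b'−1)⁻¹)⁻¹ = δ_B^{1∕2}(t)·(‖a−1‖⁻¹·χ⁻(b−1)⁻¹)⁻¹` — both sides the a.e. weight of ★ (4.9.4) VERBATIM (its Borel `letI∕haveI`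
preamble included).  Print: `Δ(m) = |D_G(m)|` is `W`-invariant; here `Δ = ‖d₀‖·‖a − 1‖·√‖b − 1‖` and §1.
[cite: Rogawski1990, §12.7 L. 12.7.2 (proof) p. 193; §4.9 (4.9.4) p. 56; §12.2 p. 173] [cite: vanDijk1972, Thm. p. 237] -/
theorem vanDijkWeight_weylConj_tokens (t t' : ↥(cmBorelTriple L 3 v).M)
    (ht' : (t' : ↥(unitaryGroupOfForm (conjLocal L (IsCMField.complexConj L) v) (cmLocalForm L 3 v))) =
      w₀ * (t : ↥(unitaryGroupOfForm (conjLocal L (IsCMField.complexConj L) v) (cmLocalForm L 3 v))) * w₀⁻¹)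
    (d : Fin 3 → (LocalRing L v)ˣ)
    (hd : glDiagonal 3 (LocalRing L v) d = ((t : ↥(unitaryGroupOfForm (conjLocal L (IsCMField.complexConj L) v) (cmLocalForm L 3 v))) : GL (Fin 3) (LocalRing L v)))
    (ha : IsUnit ((((d 0)⁻¹ * d 1 : (LocalRing L v)ˣ) : LocalRing L v) - 1))
    (hb : IsUnit ((((d 0)⁻¹ * d 2 : (LocalRing L v)ˣ) : LocalRing L v) - 1))
    (d' : Fin 3 → (LocalRing L v)ˣ)
    (hd' : glDiagonal 3 (LocalRing L v) d' = ((t' : ↥(unitaryGroupOfForm (conjLocal L (IsCMField.complexConj L) v) (cmLocalForm L 3 v))) : GL (Fin 3) (LocalRing L v)))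
    (ha' : IsUnit ((((d' 0)⁻¹ * d' 1 : (LocalRing L v)ˣ) : LocalRing L v) - 1))
    (hb' : IsUnit ((((d' 0)⁻¹ * d' 2 : (LocalRing L v)ˣ) : LocalRing L v) - 1)) :
    (haveI := locallyCompactSpace_cmBorelU L 3 v;
      ((rootDeltaChar (cmBorelTriple L 3 v).P
          ⟨(t' : ↥(unitaryGroupOfForm (conjLocal L (IsCMField.complexConj L) v) (cmLocalForm L 3 v))), (cmBorelTriple L 3 v).M_le t'.2⟩ : ℂˣ) : ℂ) *
        (((letI : MeasurableSpace (LocalRing L v) := borel _; haveI : BorelSpace (LocalRing L v) := ⟨rfl⟩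
          haveI : SecondCountableTopology (LocalRing L v) := secondCountableTopology_localRing (E := L) v
          ((distribHaarChar (LocalRing L v) ha'.unit)⁻¹ *
            (HeisRing.skewModulus (conjLocal L (IsCMField.complexConj L) v) (continuous_conjLocal L (IsCMField.complexConj L) v) hb'.unit
              (HeisRing.map_unit_torusCentralScalar_sub_one (conjLocal L (IsCMField.complexConj L) v) (cmLocalForm_eq_over L 3 v) t' hd' hb'))⁻¹ :
                ℝ≥0)) : ℝ) : ℂ)⁻¹) =
    (haveI := locallyCompactSpace_cmBorelU L 3 v;
      ((rootDeltaChar (cmBorelTriple L 3 v).P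
          ⟨(t : ↥(unitaryGroupOfForm (conjLocal L (IsCMField.complexConj L) v) (cmLocalForm L 3 v))), (cmBorelTriple L 3 v).M_le t.2⟩ : ℂˣ) : ℂ) *
        (((letI : MeasurableSpace (LocalRing L v) := borel _; haveI : BorelSpace (LocalRing L v) := ⟨rfl⟩
          haveI : SecondCountableTopology (LocalRing L v) := secondCountableTopology_localRing (E := L) v
          ((distribHaarChar (LocalRing L v) ha.unit)⁻¹ *
            (HeisRing.skewModulus (conjLocal L (IsCMField.complexConj L) v) (continuous_conjLocal L (IsCMField.complexConj L) v) hb.unit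
              (HeisRing.map_unit_torusCentralScalar_sub_one (conjLocal L (IsCMField.complexConj L) v) (cmLocalForm_eq_over L 3 v) t hd hb))⁻¹ :
                ℝ≥0)) : ℝ) : ℂ)⁻¹) := by
  haveI := locallyCompactSpace_cmBorelU L 3 v
  have h0 : d' 0 = d 2 := reflDiag_apply L v w₀ hw₀ t t' ht' hd hd' 0
  have h1 : d' 1 = d 1 := reflDiag_apply L v w₀ hw₀ t t' ht' hd hd' 1
  have h2 : d' 2 = d 0 := reflDiag_apply L v w₀ hw₀ t t' ht' hd hd' 2
  -- the two twist modules in the `‖·‖ = unitModulusChar` currency (★ `twistModule_cmLocal_eq`)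
  have key : (letI : MeasurableSpace (LocalRing L v) := borel _; haveI : BorelSpace (LocalRing L v) := ⟨rfl⟩
      haveI : SecondCountableTopology (LocalRing L v) := secondCountableTopology_localRing (E := L) v
      ((distribHaarChar (LocalRing L v) ha.unit)⁻¹ *
        (HeisRing.skewModulus (conjLocal L (IsCMField.complexConj L) v) (continuous_conjLocal L (IsCMField.complexConj L) v) hb.unit
          (HeisRing.map_unit_torusCentralScalar_sub_one (conjLocal L (IsCMField.complexConj L) v) (cmLocalForm_eq_over L 3 v) t hd hb))⁻¹ : ℝ≥0)) =
      (unitModulusChar (LocalRing L v) ha.unit * NNReal.sqrt (unitModulusChar (LocalRing L v) hb.unit))⁻¹ :=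
    twistModule_cmLocal_eq L v t.2 hd ha hb
  have key' : (letI : MeasurableSpace (LocalRing L v) := borel _; haveI : BorelSpace (LocalRing L v) := ⟨rfl⟩
      haveI : SecondCountableTopology (LocalRing L v) := secondCountableTopology_localRing (E := L) v
      ((distribHaarChar (LocalRing L v) ha'.unit)⁻¹ *
        (HeisRing.skewModulus (conjLocal L (IsCMField.complexConj L) v) (continuous_conjLocal L (IsCMField.complexConj L) v) hb'.unit
          (HeisRing.map_unit_torusCentralScalar_sub_one (conjLocal L (IsCMField.complexConj L) v) (cmLocalForm_eq_over L 3 v) t' hd' hb'))⁻¹ : ℝ≥0)) =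
      (unitModulusChar (LocalRing L v) ha'.unit * NNReal.sqrt (unitModulusChar (LocalRing L v) hb'.unit))⁻¹ :=
    twistModule_cmLocal_eq L v t'.2 hd' ha' hb'
  -- `δ_B^{1∕2}(t) = ‖d₀‖`, `δ_B^{1∕2}(ʷt) = ‖d'₀‖ = ‖d₂‖`
  have hδ : ((rootDeltaChar (cmBorelTriple L 3 v).P
        ⟨(t : ↥(unitaryGroupOfForm (conjLocal L (IsCMField.complexConj L) v) (cmLocalForm L 3 v))), (cmBorelTriple L 3 v).M_le t.2⟩ : ℂˣ) : ℂ) =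
      ((unitModulusChar (LocalRing L v) (d 0) : ℝ≥0) : ℝ) := by
    rw [← torusEntry_eq_of_glDiagonal_eq (conjLocal L (IsCMField.complexConj L) v) (cmLocalForm L 3 v) 0 t d hd]
    exact F0P2oBorelTorusModulus.rootDeltaChar_cmBorel_torus L v t
  have hδ' : ((rootDeltaChar (cmBorelTriple L 3 v).P
        ⟨(t' : ↥(unitaryGroupOfForm (conjLocal L (IsCMField.complexConj L) v) (cmLocalForm L 3 v))), (cmBorelTriple L 3 v).M_le t'.2⟩ : ℂˣ) : ℂ) =
      ((unitModulusChar (LocalRing L v) (d 2) : ℝ≥0) : ℝ) := by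
    rw [← h0, ← torusEntry_eq_of_glDiagonal_eq (conjLocal L (IsCMField.complexConj L) v) (cmLocalForm L 3 v) 0 t' d' hd']
    exact F0P2oBorelTorusModulus.rootDeltaChar_cmBorel_torus L v t'
  -- the three module identities (§1), in the `unitModulusChar` currency (`unitModulusChar R = distribHaarChar R`)
  have hA : unitModulusChar (LocalRing L v) ha'.unit = unitModulusChar (LocalRing L v) ha.unit * unitModulusChar (LocalRing L v) (d 0) := by
    letI : MeasurableSpace (LocalRing L v) := borel _
    haveI : BorelSpace (LocalRing L v) := ⟨rfl⟩
    exact distribHaarChar_reflScalar_fst (conjLocal L (IsCMField.complexConj L) v) (conjLocal_conjLocal_cm L v)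
      (continuous_conjLocal L (IsCMField.complexConj L) v) (cmLocalForm_eq_over L 3 v) t hd h0 h1 ha ha'
  have hB : NNReal.sqrt (unitModulusChar (LocalRing L v) hb'.unit) =
      NNReal.sqrt (unitModulusChar (LocalRing L v) hb.unit) * unitModulusChar (LocalRing L v) (d 0) := by
    letI : MeasurableSpace (LocalRing L v) := borel _
    haveI : BorelSpace (LocalRing L v) := ⟨rfl⟩
    exact sqrt_distribHaarChar_reflScalar_snd (conjLocal L (IsCMField.complexConj L) v) (conjLocal_conjLocal_cm L v)
      (continuous_conjLocal L (IsCMField.complexConj L) v) (cmLocalForm_eq_over L 3 v) t hd h0 h2 hb hb'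
  have h2' : unitModulusChar (LocalRing L v) (d 2) = (unitModulusChar (LocalRing L v) (d 0))⁻¹ := by
    letI : MeasurableSpace (LocalRing L v) := borel _
    haveI : BorelSpace (LocalRing L v) := ⟨rfl⟩
    exact (distribHaarChar_torus (conjLocal L (IsCMField.complexConj L) v) (conjLocal_conjLocal_cm L v)
      (continuous_conjLocal L (IsCMField.complexConj L) v) (cmLocalForm_eq_over L 3 v) t hd).2
  have hx : unitModulusChar (LocalRing L v) (d 0) ≠ 0 := by
    letI : MeasurableSpace (LocalRing L v) := borel _
    haveI : BorelSpace (LocalRing L v) := ⟨rfl⟩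
    exact (distribHaarChar_pos : 0 < distribHaarChar (LocalRing L v) (d 0)).ne'
  rw [key, key', hδ, hδ', hA, hB, h2']
  exact weight_scalar_aux _ _ _ hx


/-! ## §3 `vanDijkWeight (ʷt) = vanDijkWeight t` (LH6-p01's `dite`, regular or not), the conjugacy class of `ʷt`, and `F_φ(ω m) = F_φ(m)` -/

/-- **BRIDGE `dite` → tokens**: at a torus element REGULAR in the sense of ★ `vanDijkWeight` (`d₀⁻¹d₁ − 1`, `d₀⁻¹d₂ − 1` units for `dᵢ = torusEntry i t`), LH6-p01's
`vanDijkWeight L v t` IS the ★ (4.9.4) weight on the diagonal writing `torusEntry · t` (`dif_pos`). [cite: Rogawski1990, §12.7 L. 12.7.2 (proof) p. 193; §4.9 (4.9.4) p. 56] -/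
theorem vanDijkWeight_eq_of_isUnit (t : ↥(cmBorelTriple L 3 v).M)
    (ha : IsUnit ((((torusEntry (conjLocal L (IsCMField.complexConj L) v) (cmLocalForm L 3 v) 0 t)⁻¹ *
        torusEntry (conjLocal L (IsCMField.complexConj L) v) (cmLocalForm L 3 v) 1 t : (LocalRing L v)ˣ) : LocalRing L v) - 1))
    (hb : IsUnit ((((torusEntry (conjLocal L (IsCMField.complexConj L) v) (cmLocalForm L 3 v) 0 t)⁻¹ *
        torusEntry (conjLocal L (IsCMField.complexConj L) v) (cmLocalForm L 3 v) 2 t : (LocalRing L v)ˣ) : LocalRing L v) - 1)) :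
    F0P3cStCharTSTorusDefs.vanDijkWeight L v t =
      (haveI := locallyCompactSpace_cmBorelU L 3 v;
      ((rootDeltaChar (cmBorelTriple L 3 v).P
          ⟨(t : ↥(unitaryGroupOfForm (conjLocal L (IsCMField.complexConj L) v) (cmLocalForm L 3 v))), (cmBorelTriple L 3 v).M_le t.2⟩ : ℂˣ) : ℂ) *
        (((letI : MeasurableSpace (LocalRing L v) := borel _; haveI : BorelSpace (LocalRing L v) := ⟨rfl⟩
          haveI : SecondCountableTopology (LocalRing L v) := secondCountableTopology_localRing (E := L) v
          ((distribHaarChar (LocalRing L v) ha.unit)⁻¹ *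
            (HeisRing.skewModulus (conjLocal L (IsCMField.complexConj L) v) (continuous_conjLocal L (IsCMField.complexConj L) v) hb.unit
              (HeisRing.map_unit_torusCentralScalar_sub_one (conjLocal L (IsCMField.complexConj L) v) (cmLocalForm_eq_over L 3 v) t
                (F0P3cStCharTSTorusDefs.glDiagonal_torusEntry L v t) hb))⁻¹ :
                ℝ≥0)) : ℝ) : ℂ)⁻¹) := by
  unfold F0P3cStCharTSTorusDefs.vanDijkWeight
  exact dif_pos (And.intro ha hb)

/-- … and it is `0` at a non-regular torus element (`dif_neg`). [cite: Rogawski1990, §12.7 L. 12.7.2 (proof) p. 193] -/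
theorem vanDijkWeight_eq_zero_of_not (t : ↥(cmBorelTriple L 3 v).M)
    (h : ¬ (IsUnit ((((torusEntry (conjLocal L (IsCMField.complexConj L) v) (cmLocalForm L 3 v) 0 t)⁻¹ *
          torusEntry (conjLocal L (IsCMField.complexConj L) v) (cmLocalForm L 3 v) 1 t : (LocalRing L v)ˣ) : LocalRing L v) - 1) ∧
        IsUnit ((((torusEntry (conjLocal L (IsCMField.complexConj L) v) (cmLocalForm L 3 v) 0 t)⁻¹ *
          torusEntry (conjLocal L (IsCMField.complexConj L) v) (cmLocalForm L 3 v) 2 t : (LocalRing L v)ˣ) : LocalRing L v) - 1))) :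
    F0P3cStCharTSTorusDefs.vanDijkWeight L v t = 0 := by
  unfold F0P3cStCharTSTorusDefs.vanDijkWeight
  exact dif_neg h

include hw₀ in
/-- `ʷt` is regular iff `t` is (in the sense of ★ `vanDijkWeight`). [cite: Rogawski1990, §12.5 p. 182; §1.10 p. 9] -/
theorem isUnit_and_isUnit_weylConj_iff (t t' : ↥(cmBorelTriple L 3 v).M)
    (ht' : (t' : ↥(unitaryGroupOfForm (conjLocal L (IsCMField.complexConj L) v) (cmLocalForm L 3 v))) =
      w₀ * (t : ↥(unitaryGroupOfForm (conjLocal L (IsCMField.complexConj L) v) (cmLocalForm L 3 v))) * w₀⁻¹) :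
    (IsUnit ((((torusEntry (conjLocal L (IsCMField.complexConj L) v) (cmLocalForm L 3 v) 0 t')⁻¹ *
          torusEntry (conjLocal L (IsCMField.complexConj L) v) (cmLocalForm L 3 v) 1 t' : (LocalRing L v)ˣ) : LocalRing L v) - 1) ∧
        IsUnit ((((torusEntry (conjLocal L (IsCMField.complexConj L) v) (cmLocalForm L 3 v) 0 t')⁻¹ *
          torusEntry (conjLocal L (IsCMField.complexConj L) v) (cmLocalForm L 3 v) 2 t' : (LocalRing L v)ˣ) : LocalRing L v) - 1)) ↔
      (IsUnit ((((torusEntry (conjLocal L (IsCMField.complexConj L) v) (cmLocalForm L 3 v) 0 t)⁻¹ *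
          torusEntry (conjLocal L (IsCMField.complexConj L) v) (cmLocalForm L 3 v) 1 t : (LocalRing L v)ˣ) : LocalRing L v) - 1) ∧
        IsUnit ((((torusEntry (conjLocal L (IsCMField.complexConj L) v) (cmLocalForm L 3 v) 0 t)⁻¹ *
          torusEntry (conjLocal L (IsCMField.complexConj L) v) (cmLocalForm L 3 v) 2 t : (LocalRing L v)ˣ) : LocalRing L v) - 1)) := by
  have hd := F0P3cStCharTSTorusDefs.glDiagonal_torusEntry L v t
  have hd' := F0P3cStCharTSTorusDefs.glDiagonal_torusEntry L v t'
  have h0 : torusEntry (conjLocal L (IsCMField.complexConj L) v) (cmLocalForm L 3 v) 0 t' =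
      torusEntry (conjLocal L (IsCMField.complexConj L) v) (cmLocalForm L 3 v) 2 t := reflDiag_apply L v w₀ hw₀ t t' ht' hd hd' 0
  have h1 : torusEntry (conjLocal L (IsCMField.complexConj L) v) (cmLocalForm L 3 v) 1 t' =
      torusEntry (conjLocal L (IsCMField.complexConj L) v) (cmLocalForm L 3 v) 1 t := reflDiag_apply L v w₀ hw₀ t t' ht' hd hd' 1
  have h2 : torusEntry (conjLocal L (IsCMField.complexConj L) v) (cmLocalForm L 3 v) 2 t' =
      torusEntry (conjLocal L (IsCMField.complexConj L) v) (cmLocalForm L 3 v) 0 t := reflDiag_apply L v w₀ hw₀ t t' ht' hd hd' 2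
  constructor
  · rintro ⟨ha', hb'⟩
    exact ⟨isUnit_reflScalar_fst (conjLocal L (IsCMField.complexConj L) v) (cmLocalForm_eq_over L 3 v) t' hd'
        (d' := fun i => torusEntry (conjLocal L (IsCMField.complexConj L) v) (cmLocalForm L 3 v) i t) h2.symm h1.symm ha',
      isUnit_reflScalar_snd (d := fun i => torusEntry (conjLocal L (IsCMField.complexConj L) v) (cmLocalForm L 3 v) i t')
        (d' := fun i => torusEntry (conjLocal L (IsCMField.complexConj L) v) (cmLocalForm L 3 v) i t) h2.symm h0.symm hb'⟩
  · rintro ⟨ha, hb⟩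
    exact ⟨isUnit_reflScalar_fst (conjLocal L (IsCMField.complexConj L) v) (cmLocalForm_eq_over L 3 v) t hd
        (d' := fun i => torusEntry (conjLocal L (IsCMField.complexConj L) v) (cmLocalForm L 3 v) i t') h0 h1 ha,
      isUnit_reflScalar_snd (d := fun i => torusEntry (conjLocal L (IsCMField.complexConj L) v) (cmLocalForm L 3 v) i t)
        (d' := fun i => torusEntry (conjLocal L (IsCMField.complexConj L) v) (cmLocalForm L 3 v) i t') h0 h2 hb⟩

include hw₀ in
/-- **`Δ(ʷt) = Δ(t)` for ★ `vanDijkWeight`** (the `dite` of the TERMS leaf ★ p849564): at regular `t` this is `vanDijkWeight_weylConj_tokens` read on the diagonal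
writings `torusEntry · t`, `torusEntry · ʷt`; `ʷt` is regular iff `t` is, so at non-regular `t` both sides are `0`.
[cite: Rogawski1990, §12.7 L. 12.7.2 (proof) p. 193; §12.2 p. 173] [cite: vanDijk1972, Thm. p. 237] -/
theorem vanDijkWeight_weylConj (t t' : ↥(cmBorelTriple L 3 v).M)
    (ht' : (t' : ↥(unitaryGroupOfForm (conjLocal L (IsCMField.complexConj L) v) (cmLocalForm L 3 v))) =
      w₀ * (t : ↥(unitaryGroupOfForm (conjLocal L (IsCMField.complexConj L) v) (cmLocalForm L 3 v))) * w₀⁻¹) :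
    F0P3cStCharTSTorusDefs.vanDijkWeight L v t' = F0P3cStCharTSTorusDefs.vanDijkWeight L v t := by
  rcases Classical.em
      (IsUnit ((((torusEntry (conjLocal L (IsCMField.complexConj L) v) (cmLocalForm L 3 v) 0 t)⁻¹ *
          torusEntry (conjLocal L (IsCMField.complexConj L) v) (cmLocalForm L 3 v) 1 t : (LocalRing L v)ˣ) : LocalRing L v) - 1) ∧
        IsUnit ((((torusEntry (conjLocal L (IsCMField.complexConj L) v) (cmLocalForm L 3 v) 0 t)⁻¹ *
          torusEntry (conjLocal L (IsCMField.complexConj L) v) (cmLocalForm L 3 v) 2 t : (LocalRing L v)ˣ) : LocalRing L v) - 1)) with h | h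
  · have h' := (isUnit_and_isUnit_weylConj_iff L v w₀ hw₀ t t' ht').2 h
    rw [vanDijkWeight_eq_of_isUnit L v t h.1 h.2, vanDijkWeight_eq_of_isUnit L v t' h'.1 h'.2]
    exact vanDijkWeight_weylConj_tokens L v w₀ hw₀ t t' ht' _ (F0P3cStCharTSTorusDefs.glDiagonal_torusEntry L v t) h.1 h.2 _
      (F0P3cStCharTSTorusDefs.glDiagonal_torusEntry L v t') h'.1 h'.2
  · have h' := fun h' => h ((isUnit_and_isUnit_weylConj_iff L v w₀ hw₀ t t' ht').1 h')
    rw [vanDijkWeight_eq_zero_of_not L v t h, vanDijkWeight_eq_zero_of_not L v t' h']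

/-- **(P2) conjugate elements have the same conjugacy class** (`w t w⁻¹ ∼ t`), in any group. [folklore] -/
theorem conjClassesMk_conj {G : Type*} [Group G] (w t : G) : ConjClasses.mk (w * t * w⁻¹) = ConjClasses.mk t :=
  (ConjClasses.mk_eq_mk_iff_isConj.2 (isConj_iff.2 ⟨w, rfl⟩)).symm

/-- … and under any group homomorphism `e` (e.g. the frame `e = cmDatumLocalCongr L v T ha h` of ★ (4.9.4)): `⟦e(w t w⁻¹)⟧ = ⟦e t⟧`. [folklore] -/
theorem conjClassesMk_map_conj {G H : Type*} [Group G] [Group H] {F : Type*} [FunLike F G H] [MonoidHomClass F G H] (e : F) (w t : G) :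
    ConjClasses.mk (e (w * t * w⁻¹)) = ConjClasses.mk (e t) := by
  rw [map_mul, map_mul, map_inv]
  exact conjClassesMk_conj (e w) (e t)

/-- **The orbital integral is a class function: `Φ(⟦e(w t w⁻¹)⟧, f) = Φ(⟦e t⟧, f)`** for ★ `classOrbitalIntegral` and any hom `e` — the P2 one-liner of the census in
the currency of ★ (4.9.4) (`classOrbitalIntegral mG f (ConjClasses.mk (cmDatumLocalCongr L v T ha h ↑t))`). [cite: Rogawski1990, §4.9 p. 54; §12.7 L. 12.7.2 (proof) p. 193] -/
theorem classOrbitalIntegral_map_conj {G H : Type*} [Group G] [Group H] {E : Type*} [NormedAddCommGroup E] [NormedSpace ℝ E]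
    [∀ γ : H, MeasurableSpace (H ⧸ Subgroup.centralizer ({γ} : Set H))] (m : OrbitalMeasureFamily H) (f : H → E)
    {F : Type*} [FunLike F G H] [MonoidHomClass F G H] (e : F) (w t : G) :
    classOrbitalIntegral m f (ConjClasses.mk (e (w * t * w⁻¹))) = classOrbitalIntegral m f (ConjClasses.mk (e t)) := by
  rw [conjClassesMk_map_conj]

/-- The same without a frame (`⟦w t w⁻¹⟧ = ⟦t⟧` read by ★ `classOrbitalIntegral`). [cite: Rogawski1990, §4.9 p. 54] -/
theorem classOrbitalIntegral_conj {G : Type*} [Group G] {E : Type*} [NormedAddCommGroup E] [NormedSpace ℝ E]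
    [∀ γ : G, MeasurableSpace (G ⧸ Subgroup.centralizer ({γ} : Set G))] (m : OrbitalMeasureFamily G) (f : G → E) (w t : G) :
    classOrbitalIntegral m f (ConjClasses.mk (w * t * w⁻¹)) = classOrbitalIntegral m f (ConjClasses.mk t) := by
  rw [conjClassesMk_conj]

/-- `⟦ʷt⟧ = ⟦t⟧` ON THE ORGAN'S GROUP `Gqs L v` (= `U(Φ₃)(L⁺_v)` definitionally), in the EXACT spelling of the TERMS leaf (`ConjClasses.mk ((t : U(Φ₃)(L⁺_v)) : Gqs L v)`).
[cite: Rogawski1990, §4.9 p. 54; §1.10 p. 9] -/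
theorem conjClassesMk_gqs_weylConj (t t' : ↥(cmBorelTriple L 3 v).M)
    (ht' : (t' : ↥(unitaryGroupOfForm (conjLocal L (IsCMField.complexConj L) v) (cmLocalForm L 3 v))) =
      w₀ * (t : ↥(unitaryGroupOfForm (conjLocal L (IsCMField.complexConj L) v) (cmLocalForm L 3 v))) * w₀⁻¹) :
    ConjClasses.mk (((t' : ↥(cmBorelTriple L 3 v).M) : ↥(unitaryGroupOfForm (conjLocal L (IsCMField.complexConj L) v) (cmLocalForm L 3 v))) : Gqs L v) =
      ConjClasses.mk (((t : ↥(cmBorelTriple L 3 v).M) : ↥(unitaryGroupOfForm (conjLocal L (IsCMField.complexConj L) v) (cmLocalForm L 3 v))) : Gqs L v) := by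
  refine (ConjClasses.mk_eq_mk_iff_isConj.2 (isConj_iff.2
    ⟨((w₀ : ↥(unitaryGroupOfForm (conjLocal L (IsCMField.complexConj L) v) (cmLocalForm L 3 v))) : Gqs L v), ?_⟩)).symm
  exact congrArg (fun x : ↥(unitaryGroupOfForm (conjLocal L (IsCMField.complexConj L) v) (cmLocalForm L 3 v)) => (x : Gqs L v)) ht'.symm

/-- **`Φ^{can}(ʷt, φ) = Φ^{can}(t, φ)` ON THE ORGAN'S GROUP `Gqs L v`** (the canonical family `mQv`, identity frame), in the EXACT spelling of the TERMS leaf.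
[cite: Rogawski1990, §4.9 p. 54; §12.7 L. 12.7.2 (proof) p. 193] -/
theorem classOrbitalIntegral_gqs_weylConj [∀ γ : Gqs L v, MeasurableSpace (Gqs L v ⧸ Subgroup.centralizer ({γ} : Set (Gqs L v)))]
    (mQv : OrbitalMeasureFamily (Gqs L v)) (φ : Gqs L v → ℂ) (t t' : ↥(cmBorelTriple L 3 v).M)
    (ht' : (t' : ↥(unitaryGroupOfForm (conjLocal L (IsCMField.complexConj L) v) (cmLocalForm L 3 v))) =
      w₀ * (t : ↥(unitaryGroupOfForm (conjLocal L (IsCMField.complexConj L) v) (cmLocalForm L 3 v))) * w₀⁻¹) :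
    classOrbitalIntegral mQv φ
        (ConjClasses.mk (((t' : ↥(cmBorelTriple L 3 v).M) : ↥(unitaryGroupOfForm (conjLocal L (IsCMField.complexConj L) v) (cmLocalForm L 3 v))) : Gqs L v)) =
      classOrbitalIntegral mQv φ
        (ConjClasses.mk (((t : ↥(cmBorelTriple L 3 v).M) : ↥(unitaryGroupOfForm (conjLocal L (IsCMField.complexConj L) v) (cmLocalForm L 3 v))) : Gqs L v)) :=
  congrArg (classOrbitalIntegral mQv φ) (conjClassesMk_gqs_weylConj L v w₀ t t' ht')

include hw₀ in
/-- **`ι(ω m) = ʷ(ι m)`**: the chart of the reflected parameter `ω(α, z) = (σ(α)⁻¹, z)` IS the Weyl conjugate of the chart (★ `torusChartEntries_reflect`: reversed entries;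
★ `glDiagonal_rev_eq_weylConj`). [cite: Rogawski1990, §12.2 p. 173; §1.10 p. 9] -/
theorem torusChart_reflect (m : (LocalRing L v)ˣ × ↥(normOneUnits (conjLocal L (IsCMField.complexConj L) v))) :
    ((F0P3cStCharTSTorusDefs.torusChart L v
        ((Units.map ((conjLocal L (IsCMField.complexConj L) v : LocalRing L v →+* LocalRing L v) : LocalRing L v →* LocalRing L v) m.1)⁻¹, m.2) :
          ↥(cmBorelTriple L 3 v).M) : ↥(unitaryGroupOfForm (conjLocal L (IsCMField.complexConj L) v) (cmLocalForm L 3 v))) =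
      w₀ * ((F0P3cStCharTSTorusDefs.torusChart L v m : ↥(cmBorelTriple L 3 v).M) :
        ↥(unitaryGroupOfForm (conjLocal L (IsCMField.complexConj L) v) (cmLocalForm L 3 v))) * w₀⁻¹ := by
  apply Subtype.ext
  rw [F0P3cStCharTSTorusDefs.coe_torusChart,
    show F0P3cStCharTSTorusDefs.torusChartEntries L v
        ((Units.map ((conjLocal L (IsCMField.complexConj L) v : LocalRing L v →+* LocalRing L v) : LocalRing L v →* LocalRing L v) m.1)⁻¹, m.2) =
      fun i => F0P3cStCharTSTorusDefs.torusChartEntries L v m i.rev from funext (F0P3cStCharTSTorusDefs.torusChartEntries_reflect L v m)]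
  exact glDiagonal_rev_eq_weylConj (conjLocal L (IsCMField.complexConj L) v) (cmLocalForm_eq_over L 3 v) w₀ hw₀
    (F0P3cStCharTSTorusDefs.torusChart L v m) (F0P3cStCharTSTorusDefs.coe_torusChart L v m).symm

/-- **`F_φ(ω m) = F_φ(m)` — THE TORUS TRANSFORM OF THE TERMS LEAF IS `W`-SYMMETRIC** (★ `torusTransform L v mQv μM φ`; `ω(α, z) = (σ(α)⁻¹, z)`): `Δ(ι(ω m)) = Δ(ʷι m) =
Δ(ι m)` and `Φ^{can}(ι(ω m), φ) = Φ^{can}(ι m, φ)`, for EVERY orbital family `mQv`, Haar measure `μM`, test function `φ` and `m` (no regularity, no Weyl-element binder: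
one is produced by `exists_weylElt`).  Print: «`F_f` is `W`-invariant» (p. 193). [cite: Rogawski1990, §12.7 L. 12.7.2 (proof) p. 193; §12.2 p. 173] [cite: vanDijk1972, Thm. p. 237] -/
theorem torusTransform_reflect [MeasurableSpace (Gqs L v)]
    [∀ γ : Gqs L v, MeasurableSpace (Gqs L v ⧸ Subgroup.centralizer ({γ} : Set (Gqs L v)))]
    (mQv : OrbitalMeasureFamily (Gqs L v))
    [MeasurableSpace ((LocalRing L v)ˣ × ↥(normOneUnits (conjLocal L (IsCMField.complexConj L) v)))]
    (μM : Measure ((LocalRing L v)ˣ × ↥(normOneUnits (conjLocal L (IsCMField.complexConj L) v))))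
    (φ : Gqs L v → ℂ) (m : (LocalRing L v)ˣ × ↥(normOneUnits (conjLocal L (IsCMField.complexConj L) v))) :
    F0P3cStCharTSTorusDefs.torusTransform L v mQv μM φ
        ((Units.map ((conjLocal L (IsCMField.complexConj L) v : LocalRing L v →+* LocalRing L v) : LocalRing L v →* LocalRing L v) m.1)⁻¹, m.2) =
      F0P3cStCharTSTorusDefs.torusTransform L v mQv μM φ m := by
  obtain ⟨w₀, hw₀⟩ := exists_weylElt L v
  have hι := torusChart_reflect L v w₀ hw₀ m
  have hW := vanDijkWeight_weylConj L v w₀ hw₀ (F0P3cStCharTSTorusDefs.torusChart L v m) _ hι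
  have hO := classOrbitalIntegral_gqs_weylConj L v w₀ mQv φ (F0P3cStCharTSTorusDefs.torusChart L v m) _ hι
  unfold F0P3cStCharTSTorusDefs.torusTransform
  dsimp only
  rw [hW]
  exact congrArg _ (congrArg _ hO)

end CM

end Summit.HodgeConjecture.HodgeConjecture.Cruxes.H413.F0P3cStCharTSVanDijkWeylSymm

end
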